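import Mathlib
import HarnessLib
import HarnessLib.Audit
import Summits.ABC.Statement
import Literature.Barriers.ABC.BakerMethodBoundsStewartYu1991OfYu1990Proofs
import Literature.Barriers.ABC.BakerMethodBounds
import HarnessLib.Audit.Status.Attr

/-!
Route: PadicPrimesYuNinety

CLOSED (superseded) 2026-08-26T13:17:04Z by planner-abc-stewartyu-plan-g6-0 — reason: superseded:route-ABC-PadicPrimesW80TwoThirds — superseded by route-ABC-PadicPrimesW80TwoThirds — note: PATH Y′ fallback retired: rung A1.M2 = Literature.Barriers.ABC.stewartYu1991_upperBound decided by route-ABC-PadicPrimesW80TwoThirds (all 3 cruxes 19485/19486/19487 + Assembly 19488 CLOSED·proved 13:14:34Z; by-name stewartYu1991_holds p447866). YuNinety items 19249–19251 never staffed after the W80 . The file is kept as the record of this route; refuted decls are indexed as negative knowledge (`ledger negatives`).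

# Route PadicPrimesYuNinety — log c ≪_ε rad^(2/3+ε) (Stewart–Yu 1991) from Yu 1990 for rational
primes, split p ≡ 3, p ≡ 1 (mod 4), p = 2

RUNG ROUTE A1.M2 (D-0059/D-0061, class rung `stewartYu1991_upperBound` = log c ≤
κ(ε)·rad(abc)^(2/3+ε), never summit
credit): it suffices to show Yu's 1990 p-adic bound for RATIONAL PRIMES — for every prime p and
every finite set S of
primes q ≠ p, ord_p(∏ q^(e_q) − 1) < (c₅·#S)^(#S) · p² · log B · log log A · ∏ log max(4,q) (B ≥
max(3,|e_q|),
A = max(4, max S)) — because the PROVED tree theorem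
`Literature.Barriers.ABC.stewartYu1991_of_yu1990 c₅ hY` turns exactly
this binder into the leaf (archimedean input = the proved `waldschmidt1980_hW₂`, combination =
Stewart–Yu 1991 §3, proved).
X = X₃ ∧ X₁ ∧ X₂ is filed as THREE cruxes along the field-theoretic seam of Yu's method (q = 2
Kummer descent needs
ζ₄ ∈ K): X₃ = the binder at p ≡ 3 (mod 4) (K = ℚ suffices: μ = ord₂(p−1) = 1 = u, α₀ = −1, Kummer
(2.15) =
[ℚ(i,√q₁,…,√qₙ):ℚ] = 2^(n+1), LANDED p413365), X₁ = at p ≡ 1 (mod 4) (2 ∈ S forces K = ℚ(i) ↪ ℚ_p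
and the generator
1+i, Stewart–Yu's device), X₂ = at p = 2 (S odd; q = 3 cube-root descent). The glue merges the three
constants
(c := max |c₃| |c₁| |c₂|, monotonicity of (c·n)^n in c ≥ 0) and case-splits on p mod 4 (glue.lean,
farm rc 0).
Lean: `∃ c₅ : ℝ, ∀ (p : ℕ), p.Prime → ∀ (S : Finset ℕ), (∀ q ∈ S, q.Prime) → p ∉ S → S.Nonempty → ∀
(e : ℕ → ℤ) (B : ℝ), 3 ≤ B → (∀ q ∈ S, (|e q| : ℝ) ≤ B) → ∏ q ∈ S, (q : ℚ) ^ e q ≠ 1 → (padicValRat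
p (∏ q ∈ S, (q : ℚ) ^ e q - 1) : ℝ) < (c₅ * S.card) ^ S.card * (p : ℝ) ^ 2 * Real.log B * Real.log
(Real.log ((max 4 (S.sup id) : ℕ) : ℝ)) * ∏ q ∈ S, Real.log ((max 4 q : ℕ) : ℝ)`

## Assembly
Pure logic plus the proved door: from the three cruxes obtain c₃, c₁, c₂; set c := max (max |c₃|
|c₁|) |c₂|; for a prime p
the binder hY of `stewartYu1991_of_yu1990 c` follows from the crux of p's residue class (p = 2 ∨ p %
4 = 1 ∨ p % 4 = 3 by
`Nat.Prime.eq_two_or_odd` + omega) and monotonicity of (c'·n)^n·(non-negative tail) in c' ≤ c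
(le_abs_self, pow_le_pow_left₀);
then `stewartYu1991_of_yu1990 c hY : stewartYu1991_upperBound`. The deciding theorem `closes (h₃ :
YuNinetyThreeModFour)
(h₁ : YuNinetyOneModFour) (h₂ : YuNinetyTwo) : Literature.Barriers.ABC.stewartYu1991_upperBound` is
glue.lean (farm rc 0,
all three binders consumed).

CLOSES_TARGET: closes rung F-A1.M2 of ABC: Literature.Barriers.ABC.stewartYu1991_upperBound (D-0061; not the summit Statement) — the deciding theorem of this route concludes that registered leaf instead of the Statement decl `ABC` (class rung: servable and labelled, never counted as concluding the summit Statement).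

Rationale: WHY THIS LINE. Stewart–Yu 1991 (Math. Ann. 291, Thm 1) = Yu 1990 (Compositio Math. 74, Thm 1 / Cor.
of §0 p. 17, rational case p. 20)
at the finite places + Waldschmidt 1980 at the infinite place + an elementary three-routes
combination; the tree has PROVED
the last two (`waldschmidt1980_hW₂`, `stewartYu1991_of_yu1990`), so the rung is exactly the p-adic
binder hY [Yu1990,
StewartYu1991, Waldschmidt2014 §2]. The cell's landed engine (Theorem A for PRINCIPAL units,
`padicTheoremAOne_holds`,
C(m) ≤ (2⁷⁰)^m·m^m, modules PadicCW77*) cannot reach hY through the outside lattice reduction WP-M: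
Minkowski's
m!·index is tight, so that road stops at n-exponent κ = 2 (DAG ERRATUM 2; rung RadTwo), while the
door needs κ = 1 and p².
Yu's way is the (p^f − 1)-twist α ↦ α^(p^κ)·ζ^r carried INSIDE the auxiliary polynomial (his
(2.23)–(2.25)), costing p/(log p)^(n+2)
per prime instead of p^n (naive principalisation) or m!² (lattice) — an ENGINE change, which the
director ruled is a crux
inside this route, not a precondition (INBOX 2026-08-26T01:27:31Z). Imported from transcendence
theory: Yu's p-adic
Baker method with Kummer descent; the split by p mod 4 is forced by (2.1) ζ_q ∈ K with q = 2: over K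
= ℚ the Kummer
step (U3) holds iff the 2^(μ+2)-th cyclotomic polynomial stays irreducible over ℚ(√q₁,…,√qₙ), true
at p ≡ 3 (mod 4)
(μ = 1, ℚ(i)) and false at p ≡ 1 (mod 4) as soon as 2 ∈ S (√2 ∈ ℚ(ζ₈)); at p = 2 the square-root
descent has no
Kummer-valid principal generators (planner finding: Λ^(16) has a basis with 𝔽₂-independent image
only if every q ≡ ±1, ±7
(mod 16)), hence q = 3. No prior route of the summit types Yu 1990; the negatives index has no
Baker-class statement.

RANKED CRUXES. #2 YuNinetyThreeModFour (crux) — Yu 1990 for rational primes at the primes p ≡ 3 (mod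
4): for S a finite non-empty set of primes q ≠ p, exponents |e_q| ≤ B (B ≥ 3), ∏ q^(e_q) ≠ 1:
ord_p(∏ q^(e_q) − 1) < (c₅·#S)^(#S)·p²·log B·log log max(4, max S)·∏ log max(4,q). Line (birth
skeleton `Lines/birth.lean`): stub_engine = the K = ℚ twist engine for arbitrary p-adic units in
Theorem-A clothing with the PRODUCT shape C(m)·p·∏(Vⱼ/log p)·W·(log Vmax + log p)/(log p)², C(m) ≤
c₁^m·m^m; stub_transfer = bookkeeping (αⱼ = qⱼ, Vⱼ = log p·log max(4,qⱼ), W = log B). [difficulty: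
XL] (why it might fail: True in print (Yu 1990); as typed the door tolerates NO (log log A)² term,
so the engine must give Yu's W*·log V* product shape with (log p)^-(n+2) normalisation
((2.30)–(2.31)); the cell's landed Theorem A has (W+L)·L and r = 0 — the twist engine over K = ℚ is
unbuilt (≈ 12 pp. delta).) [Yu1990, StewartYu1991, Waldschmidt2014]
#3 YuNinetyOneModFour (crux) — the same bound at the primes p ≡ 1 (mod 4). Line (birth skeleton):
stub_engineGauss = Yu 1990 Thm 1 over K = ℚ(i) at a split prime, stated inside ℚ_[p] with a chosen
ι, ι² = −1, generators 1 + ι and the odd primes of S, output already in the door's shape with #S + 1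
generators; stub_transferGauss = (1+ι)⁸ = 16, ord_p(u − 1) ≤ ord_p(u⁴ − 1), log(8B) ≤ 3 log B,
(n+1)^(n+1) ≤ 4^n·n^n·4. [difficulty: XL] (why it might fail: With 2 ∈ S the ℚ-Kummer step is false
at p ≡ 1 (mod 4) (√2 ∈ ℚ(ζ₈)); the line needs heights, Liouville and the auxiliary construction over
ℚ(i) (D = 2, t-split (2.26) live, α₀ = i) — the tree's height/Liouville kit is over ℚ only; the
(1+i)-transfer must keep log(8B) ≤ 3 log B.) [Yu1990, StewartYu1991]
#4 YuNinetyTwo (crux) — the same bound at p = 2 for sets S of odd primes: ord₂(∏ q^(e_q) − 1) <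
(c₅·#S)^(#S)·4·log B·log log max(4, max S)·∏ log max(4,q). Line (birth skeleton): stub_engineTwo = a
2-adic Theorem A for principal units αⱼ ≡ 1 (mod 8) under a CUBE-Kummer condition (q = 3 descent
over K = ℚ: ∛αⱼ ∈ ℤ₂ by Hensel, 3^m classes separated by linear independence of the monomials ∏
∛αⱼ^(λⱼ) over ℚ, third-points s/3 of norm 1 inside the radius-2 disc, explicit cubic norm forms for
Liouville), bound C(m)·∏Vⱼ·W·(1 + log Vmax); stub_transferTwo = αⱼ = qⱼ² (≡ 1 mod 8; squares of
distinct primes are cube-independent), ord₂(u−1) ≤ ord₂(u²−1). [difficulty: XL] (why it might fail: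
At p = 2 the square-root descent is dead (no Kummer-valid principal generators mod 16, e.g. S = {7,
23}); all rides on an untyped q = 3 descent: new HalfStep/Siegel/Endgame combinatorics (3^m classes,
cubic norm forms), §2.6 numerics redone with f·log p = log 2 < 1 (Yu uses ℚ(ζ₃)).) [Yu1990,
StewartYu1991, Yu1989]

TWO-LAYER PLAN. Foreseen glued splits once the engines are typed as items (layer 2, not filed now):
YuNinetyThreeModFour ⇐ EngineThreeModFour →
(EngineThreeModFour → YuNinetyThreeModFour); YuNinetyOneModFour ⇐ GaussEngineOneModFour → (… →
YuNinetyOneModFour); YuNinetyTwo ⇐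
TwoAdicPrincipalCubic → (… → YuNinetyTwo) — exactly the registered birth skeletons; a prover who
closes a transfer stub may propose
the split with `--split <Crux> --into <Engine> <Transfer>`.

KILL CRITERIA. No mathematical kill expected (published: Yu 1990 Thm 1 + Stewart–Yu 1991 §3). A
refutation of a crux AS TYPED can only come
from the typed shape at tiny parameters (the `max 4` / `3 ≤ B` guards, the strict `<`) → class
misstated, repaired by a restated
item, not retirement. The route is closed `superseded` if rung A1.M3 (Yu 2007 for ℚ, door
`stewartYu1991_of_yu`) lands first,
and any crux closes for free if a prover lands the whole binder hY (the union statement) — then the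
other two follow by restriction.

NOT DECOMPOSED YET. The three engines (EngineThreeModFour, GaussEngineOneModFour,
TwoAdicPrincipalCubic) are STUBS in the birth skeletons, not items:
their exact clothing (product shape W·(log Vmax + log p), the (log p)^2 normalisation, the
cube-Kummer phrasing, `Padic.valuation`
vs `padicValRat`) is for p2/p3 to confirm against the landed PadicCW77* interfaces before they
become layer-2 items; constants
(c₁, the 2⁷⁰-type envelope) are deliberately existential; the K = ℚ(i) height/Liouville kit and the
cubic norm-form recursion are
support work filed by provers `--supports <crux item>`.

CHEAPEST FALSIFIER. The one-prime case (card S = 1) in all three residue classes at once: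
`yuNinetyPrimes_card_one` (c₅ = 40) is PROVED on the farm (HOME/plan/routes/bc/
YuNinetyPrimes_rung.lean, rc 0, 0 sorries; from the tree's one-logarithm lemma
`Dioph.padicValRat_zpow_sub_one_mul_log_le_sharp`)
— the typed shape survives the one-prime test incl. q = 2, 3 where log log 4 = 0.33. Next cheapest:
card S = 2 at p = 2, S = {3, 5}:
ord₂(3^a·5^b − 1) ≤ 3 + log₂ max(|a|,|b|) by lifting-the-exponent, against (2c₅)²·4·log B·log log
5·log 4·log 5 ≈ 84·c₅²·log B — holds for c₅ ≥ 1.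

NUMBERS. Exponents of record (Waldschmidt2014 §2; tree doors): Stewart–Tijdeman 1986 rad^15 (A1.M1,
closed in-tree via this cell's
Theorem A), Stewart–Yu 1991 rad^(2/3+ε) (THIS rung; needs κ = 1, p²), Stewart–Yu 2001 rad^(1/3)(log
rad)³ (A1.M3; needs Yu 2007
p with no log p loss, acq-02896/acq-02484 open). Engine prices per prime: naive principalisation
p^n; lattice WP-M m^(2m)·p (landed,
`WPM` item closed); Yu's internal twist p/(log p)^(n+2) [Yu1990 Thm 1]. Theorem A landed: c₁ = 2⁷⁰,
c₂ = 1, r = 0 (p413280, p413751).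

DEFINITION REQUESTS. None at open. Possibly later (layer 2): `logHeight` on ℚ(i) (or a
Gaussian-integer height surrogate) for GaussEngineOneModFour —
to be requested by the prover who types that engine as an item.

Novelty: Searches (2026-08-25/26): lean search 'stewartYu1991_of' → 9 tree DOORS (of_yu1990,
of_yu1990_waldschmidt1980(_explicit),
of_padicClause, of_padicBound, of_yu, of_thm328Finite, of_stewartYu, of_evertseGyory), no proof of a
p-adic bound for ≥ 2
logarithms anywhere in the tree; lean search 'padicValRat .* Finset.prod|yuNinety' → only this
cell's files; ledger negatives
--problem ABC → no Baker-class statement; lit: [corpus: Yu1990 = Compositio Math. 74 (1990) 15–113,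
page map in HOME/lit/SOURCES.md
§11; StewartYu1991 via Waldschmidt2014 §2]; lit galaxy search "linear forms in p-adic
logarithms|Kummer descent" --star all (g1/g2
sessions: Yu 1989/1990/1998/2007, Fuchs–Pham 2015, Bugeaud 2018 — all inside the class). Nearest
prior art found: Yu1990 (the
theorem itself) and the tree's own door `stewartYu1991_of_yu1990`. Delta: none claimed
mathematically — class rung (known result,
unformalised); the only twists are organisational (K = ℚ at p ≡ 3 (mod 4); the 1+i device as a typed
transfer; q = 3 over ℚ with
generators q² ≡ 1 (mod 8) at p = 2 instead of Yu's ℚ(ζ₃)).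
Claimed grade: known  [refs: Yu1990, StewartYu1991, Waldschmidt2014]

Barriers (technique_class: baker-linear-forms, padic-auxiliary-polynomial, kummer-theory): - technique_class: baker-linear-forms, padic-auxiliary-polynomial, kummer-theory
- Literature.Barriers.ABC.BakerMethodBounds: it does not evade it — inside the class by design (rung
A1.M2 = rad^(2/3+ε), exponential in rad; the barrier's scope caveat (a): no impossibility theorem,
only "a new idea is needed to go significantly further"); the bet is a kernel-checked rung, not
summit distance.
- Literature.Barriers.ABC.EpsilonCannotBeDropped: not applicable (the rung keeps ε and is far weaker
than abc).
- Negatives index: empty for this technique class at filing (ledger negatives --problem ABC,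
2026-08-26); the refuted statements of the summit are of other routes' shapes (no
padicValRat/product-of-primes statement).

History (route lifecycle, newest last):
- 2026-08-26T13:17:04Z · CLOSED superseded — superseded:route-ABC-PadicPrimesW80TwoThirds (planner-abc-stewartyu-plan-g6-0)

sub-problem: ABC · status: closed(superseded) · opened planner-abc-stewartyu-plan-g3-0 2026-08-26T02:44:44Z · rev 0 · ledger route-ABC-PadicPrimesYuNinety
GENERATED by the gate from the ledger (D-0016/17). Provers cite these decls: `theorem foo : Summit.ABC.ABC.Theses.PadicPrimesYuNinety.<Decl> := …` in Summits/ABC/ABC/Theorems/<Name>.lean.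
-/

namespace Summit.ABC.ABC.Theses.PadicPrimesYuNinety

open scoped BigOperators Topology Manifold Classical MeasureTheory ProbabilityTheory Matrix InnerProductSpace ComplexConjugate ContinuousMap
open Filter Set Function TopologicalSpace MeasureTheory

attribute [summit_statement] _root_.ABC
attribute [summit_statement] _root_.Literature.Barriers.ABC.stewartYu1991_upperBound

open Literature.Abc

/-- item stmt-ABC-19249 · crux · rank 2 · closed · moot by None · by planner
why it might fail: True in print (Yu 1990); as typed the door tolerates NO (log log A)² term, so the engine must give Yu's W*·log V* product shape with (log p)^-(n+2) normalisation ((2.30)–(2.31)); the cell's landed Theorem A has (W+L)·L and r = 0 — the twist engine over K = ℚ is unbuilt (≈ 12 pp. delta).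
sources: Yu1990, StewartYu1991, Waldschmidt2014
[crux] Yu 1990 for rational primes at the primes p ≡ 3 (mod 4): for S a finite non-empty set of
primes q ≠ p, exponents |e_q| ≤ B (B ≥ 3), ∏ q^(e_q) ≠ 1: ord_p(∏ q^(e_q) − 1) < (c₅·#S)^(#S)·p²·log
B·log log max(4, max S)·∏ log max(4,q). Line (birth skeleton `Lines/birth.lean`): stub_engine = the
K = ℚ twist engine for arbitrary p-adic units in Theorem-A clothing with the PRODUCT shape
C(m)·p·∏(Vⱼ/log p)·W·(log Vmax + log p)/(log p)², C(m) ≤ c₁^m·m^m; stub_transfer = bookkeeping (αⱼ =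
qⱼ, Vⱼ = log p·log max(4,qⱼ), W = log B). [difficulty: XL] -/
@[route_item "route-ABC-PadicPrimesYuNinety", crux]
def YuNinetyThreeModFour : Prop :=
  ∃ c₅ : ℝ, ∀ (p : ℕ), p.Prime → p % 4 = 3 → ∀ (S : Finset ℕ), (∀ q ∈ S, q.Prime) → p ∉ S → S.Nonempty → ∀ (e : ℕ → ℤ) (B : ℝ), 3 ≤ B → (∀ q ∈ S, (|e q| : ℝ) ≤ B) → ∏ q ∈ S, (q : ℚ) ^ e q ≠ 1 → (padicValRat p (∏ q ∈ S, (q : ℚ) ^ e q - 1) : ℝ) < (c₅ * S.card) ^ S.card * (p : ℝ) ^ 2 * Real.log B * Real.log (Real.log ((max 4 (S.sup id) : ℕ) : ℝ)) * ∏ q ∈ S, Real.log ((max 4 q : ℕ) : ℝ)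

/-- item stmt-ABC-19250 · crux · rank 3 · closed · moot by None · by planner
why it might fail: With 2 ∈ S the ℚ-Kummer step is false at p ≡ 1 (mod 4) (√2 ∈ ℚ(ζ₈)); the line needs heights, Liouville and the auxiliary construction over ℚ(i) (D = 2, t-split (2.26) live, α₀ = i) — the tree's height/Liouville kit is over ℚ only; the (1+i)-transfer must keep log(8B) ≤ 3 log B.
sources: Yu1990, StewartYu1991
[crux] the same bound at the primes p ≡ 1 (mod 4). Line (birth skeleton): stub_engineGauss = Yu 1990
Thm 1 over K = ℚ(i) at a split prime, stated inside ℚ_[p] with a chosen ι, ι² = −1, generators 1 + ι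
and the odd primes of S, output already in the door's shape with #S + 1 generators;
stub_transferGauss = (1+ι)⁸ = 16, ord_p(u − 1) ≤ ord_p(u⁴ − 1), log(8B) ≤ 3 log B, (n+1)^(n+1) ≤
4^n·n^n·4. [difficulty: XL] -/
@[route_item "route-ABC-PadicPrimesYuNinety", crux]
def YuNinetyOneModFour : Prop :=
  ∃ c₅ : ℝ, ∀ (p : ℕ), p.Prime → p % 4 = 1 → ∀ (S : Finset ℕ), (∀ q ∈ S, q.Prime) → p ∉ S → S.Nonempty → ∀ (e : ℕ → ℤ) (B : ℝ), 3 ≤ B → (∀ q ∈ S, (|e q| : ℝ) ≤ B) → ∏ q ∈ S, (q : ℚ) ^ e q ≠ 1 → (padicValRat p (∏ q ∈ S, (q : ℚ) ^ e q - 1) : ℝ) < (c₅ * S.card) ^ S.card * (p : ℝ) ^ 2 * Real.log B * Real.log (Real.log ((max 4 (S.sup id) : ℕ) : ℝ)) * ∏ q ∈ S, Real.log ((max 4 q : ℕ) : ℝ)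

/-- item stmt-ABC-19251 · crux · rank 4 · closed · moot by None · by planner
why it might fail: At p = 2 the square-root descent is dead (no Kummer-valid principal generators mod 16, e.g. S = {7, 23}); all rides on an untyped q = 3 descent: new HalfStep/Siegel/Endgame combinatorics (3^m classes, cubic norm forms), §2.6 numerics redone with f·log p = log 2 < 1 (Yu uses ℚ(ζ₃)).
sources: Yu1990, StewartYu1991, Yu1989
[crux] the same bound at p = 2 for sets S of odd primes: ord₂(∏ q^(e_q) − 1) < (c₅·#S)^(#S)·4·log
B·log log max(4, max S)·∏ log max(4,q). Line (birth skeleton): stub_engineTwo = a 2-adic Theorem A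
for principal units αⱼ ≡ 1 (mod 8) under a CUBE-Kummer condition (q = 3 descent over K = ℚ: ∛αⱼ ∈ ℤ₂
by Hensel, 3^m classes separated by linear independence of the monomials ∏ ∛αⱼ^(λⱼ) over ℚ,
third-points s/3 of norm 1 inside the radius-2 disc, explicit cubic norm forms for Liouville), bound
C(m)·∏Vⱼ·W·(1 + log Vmax); stub_transferTwo = αⱼ = qⱼ² (≡ 1 mod 8; squares of distinct primes are
cube-independent), ord₂(u−1) ≤ ord₂(u²−1). [difficulty: XL] -/
@[route_item "route-ABC-PadicPrimesYuNinety", crux]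
def YuNinetyTwo : Prop :=
  ∃ c₅ : ℝ, ∀ (S : Finset ℕ), (∀ q ∈ S, q.Prime) → 2 ∉ S → S.Nonempty → ∀ (e : ℕ → ℤ) (B : ℝ), 3 ≤ B → (∀ q ∈ S, (|e q| : ℝ) ≤ B) → ∏ q ∈ S, (q : ℚ) ^ e q ≠ 1 → (padicValRat 2 (∏ q ∈ S, (q : ℚ) ^ e q - 1) : ℝ) < (c₅ * S.card) ^ S.card * (2 : ℝ) ^ 2 * Real.log B * Real.log (Real.log ((max 4 (S.sup id) : ℕ) : ℝ)) * ∏ q ∈ S, Real.log ((max 4 q : ℕ) : ℝ)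

/-- item stmt-ABC-19252 · assembly · rank 1 · closed · moot by None · by planner
sources: StewartYu1991, Yu1990
[assembly] YuNinetyThreeModFour → YuNinetyOneModFour → YuNinetyTwo → the rung leaf
stewartYu1991_upperBound (`closes_target`), by the door `stewartYu1991_of_yu1990` with the merged
constant. -/
@[route_item "route-ABC-PadicPrimesYuNinety"]
def Assembly : Prop :=
  YuNinetyThreeModFour → YuNinetyOneModFour → YuNinetyTwo → Literature.Barriers.ABC.stewartYu1991_upperBound

/-! D-0027 §2.1 — DECIDING THEOREM (planner-authored via `route open/edit --closes-file`; by planner-abc-stewartyu-plan-g3-0 2026-08-26T02:44:44Z) — ARCHIVED: route closed (superseded) 2026-08-26T13:17:04Z; kept so importers keep building: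
its hypotheses are this route's items and its conclusion the registered leaf `Literature.Barriers.ABC.stewartYu1991_upperBound` (rung F-A1.M2, D-0061) (glue_lint), and it elaborates with this file. -/

@[closes "route-ABC-PadicPrimesYuNinety"] theorem closes (h₃ : YuNinetyThreeModFour) (h₁ : YuNinetyOneModFour) (h₂ : YuNinetyTwo) :
    Literature.Barriers.ABC.stewartYu1991_upperBound := by
  obtain ⟨c₃, H₃⟩ := h₃
  obtain ⟨c₁, H₁⟩ := h₁
  obtain ⟨c₂, H₂⟩ := h₂
  refine Literature.Barriers.ABC.stewartYu1991_of_yu1990 (max (max |c₃| |c₁|) |c₂|) ?_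
  intro p hp S hS hpS hne e B hB heB hne1
  -- the tail of the bound is non-negative, so the constant may be enlarged
  have h4 : (4 : ℝ) ≤ ((max 4 (S.sup id) : ℕ) : ℝ) := by exact_mod_cast le_max_left _ _
  have hlog4 : (1 : ℝ) ≤ Real.log ((max 4 (S.sup id) : ℕ) : ℝ) := by
    have he : Real.exp 1 ≤ 4 := by have := Real.exp_one_lt_d9; linarith
    calc (1 : ℝ) = Real.log (Real.exp 1) := (Real.log_exp 1).symm
      _ ≤ Real.log 4 := Real.log_le_log (Real.exp_pos 1) he
      _ ≤ _ := Real.log_le_log (by norm_num) h4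
  have hT : 0 ≤ (p : ℝ) ^ 2 * Real.log B * Real.log (Real.log ((max 4 (S.sup id) : ℕ) : ℝ)) *
      ∏ q ∈ S, Real.log ((max 4 q : ℕ) : ℝ) := by
    have hB' : 0 ≤ Real.log B := Real.log_nonneg (by linarith)
    have hLL : 0 ≤ Real.log (Real.log ((max 4 (S.sup id) : ℕ) : ℝ)) := Real.log_nonneg hlog4
    have hP : 0 ≤ ∏ q ∈ S, Real.log ((max 4 q : ℕ) : ℝ) :=
      Finset.prod_nonneg fun q _ => Real.log_nonneg (by exact_mod_cast le_max_of_le_left (by norm_num))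
    positivity
  have mono : ∀ c : ℝ, |c| ≤ max (max |c₃| |c₁|) |c₂| → ∀ v : ℝ,
      v < (c * S.card) ^ S.card * (p : ℝ) ^ 2 * Real.log B *
          Real.log (Real.log ((max 4 (S.sup id) : ℕ) : ℝ)) * ∏ q ∈ S, Real.log ((max 4 q : ℕ) : ℝ) →
      v < (max (max |c₃| |c₁|) |c₂| * S.card) ^ S.card * (p : ℝ) ^ 2 * Real.log B *
          Real.log (Real.log ((max 4 (S.sup id) : ℕ) : ℝ)) * ∏ q ∈ S, Real.log ((max 4 q : ℕ) : ℝ) := by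
    intro c hc v hv
    have hpow : (c * S.card) ^ S.card ≤ (max (max |c₃| |c₁|) |c₂| * S.card) ^ S.card := by
      calc (c * S.card) ^ S.card ≤ |(c * S.card) ^ S.card| := le_abs_self _
        _ = (|c| * S.card) ^ S.card := by rw [abs_pow, abs_mul, Nat.abs_cast]
        _ ≤ _ := pow_le_pow_left₀ (by positivity)
              (mul_le_mul_of_nonneg_right hc (Nat.cast_nonneg _)) _
    refine lt_of_lt_of_le hv ?_
    have := mul_le_mul_of_nonneg_right hpow hT
    calc (c * S.card) ^ S.card * (p : ℝ) ^ 2 * Real.log B *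
          Real.log (Real.log ((max 4 (S.sup id) : ℕ) : ℝ)) * ∏ q ∈ S, Real.log ((max 4 q : ℕ) : ℝ)
        = (c * S.card) ^ S.card * ((p : ℝ) ^ 2 * Real.log B *
          Real.log (Real.log ((max 4 (S.sup id) : ℕ) : ℝ)) * ∏ q ∈ S, Real.log ((max 4 q : ℕ) : ℝ)) := by
          ring
      _ ≤ (max (max |c₃| |c₁|) |c₂| * S.card) ^ S.card * ((p : ℝ) ^ 2 * Real.log B *
          Real.log (Real.log ((max 4 (S.sup id) : ℕ) : ℝ)) * ∏ q ∈ S, Real.log ((max 4 q : ℕ) : ℝ)) :=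
          this
      _ = _ := by ring
  rcases hp.eq_two_or_odd with hp2 | hodd
  · subst hp2
    have h := H₂ S hS hpS hne e B hB heB hne1
    refine mono c₂ (le_max_right _ _) _ ?_
    simpa only [Nat.cast_ofNat] using h
  · have h13 : p % 4 = 1 ∨ p % 4 = 3 := by omega
    rcases h13 with h1 | h3
    · exact mono c₁ ((le_max_right _ _).trans (le_max_left _ _)) _
        (H₁ p hp h1 S hS hpS hne e B hB heB hne1)
    · exact mono c₃ ((le_max_left _ _).trans (le_max_left _ _)) _
        (H₃ p hp h3 S hS hpS hne e B hB heB hne1)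

end Summit.ABC.ABC.Theses.PadicPrimesYuNinety
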